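import Summits.BirchSwinnertonDyer.BirchSwinnertonDyer.Theorems.GoldfeldAllTwistsTwoConverseTwinNonSharpSelmerDualThreeOne
import Summits.BirchSwinnertonDyer.BirchSwinnertonDyer.Theorems.GoldfeldAllTwistsTwoConverseTwinAdditiveInertTwistDescent
import Summits.BirchSwinnertonDyer.BirchSwinnertonDyer.Theorems.GoldfeldAllTwistsTwoConverseTwinNonSharpRankThree
import HarnessLib

set_option linter.dupNamespace false -- namespace `…BirchSwinnertonDyer.BirchSwinnertonDyer…` is the cell's (D-0017 nested layout)
set_option autoImplicit false

/-!
# First descent on the stratum `q ≡ 3 (8)` of `W ≅ 49a1^{(−2qp)}` WITHOUT type or `(p/q)` condition, II: `S = S(−42qp, 448q²p²) ⊆ {1, 7, p, 7p, 2p, 14p}`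
# for every `p ≡ 1 (4)`, hence `#S ≤ 4` and, with file 1, `rank W(ℚ) ≤ 3` for EVERY `W` with `p ≡ 1 (8)` — in particular on the `(4,8)` cells C1 and b31+,
# where `3` is ATTAINED (OBJECT 9): `rank = 3` at `(19, 337)` and at `(139, 193)`

Cell `bsd-goldfeld`, seat `bsd-goldfeld-s1p-c3x` (gen 21); planner RULING (cdxxxviii), OPTIONAL OBJECT 10 «FIRST-DESCENT UPPER BOUNDS ON THE (4,8)
CELLS», TRANCHE B (b31+) ∪ the C1 half of TRANCHE C, file 2 of 2. `--supports stmt-BirchSwinnertonDyer-20044` as a HELPER (rank axis). FACT-FREE: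
no print binder, no definition, no `sorry`; Theses-free.

§1 **`S(−42qp, 448q²p²) ⊆ {1, 7, p, 7p, 2p, 14p}`** for `q ≡ 3 (8)`, `(q/7) = −1`, `p ≡ 1 (4)` (no `(−7/p)`, no type, no `(p/q)`; so ALSO the cell C2,
`p ≡ 5 (8)`): the (β,−) cell's proof (`twoIsogenySelmerGroup_twoPrimesTwist_subset_pair_threeModEightPOne`, `…SelmerThreeModEightPOne`) with its
`q`-adic kills of `p, 7p` (`(p/q) = −1`) and its type-β kills of `2p, 14p` DELETED: negatives die over `ℝ`, the eight `q`-classes at `q` (`(−7/q) = −1`),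
`2, 14` at `q` (`(2/q) = −1`, `(7/q) = +1`; `not_isSoluble_padic_of_nonresidue_of_sq_dvd`); the six classes `1, 7, p, 7p, 2p, 14p` are not touched — and
indeed no `p`-class dies uniformly: b31+ keeps `p, 7p` (kit j332195: `S = {1, 7, p, 7p}`), C1 and C2 keep `2p, 14p` (kit j332292: `S = {1, 7, 2p, 14p}`).
Since `#S` is a power of two (`two_pow_twoIsogenySelmerRank_eq_card`), `#S ≤ 6` gives `dim₂ S ≤ 2`.
§2 **The count** on the stratum `q ≡ 3 (8)`, `(q/7) = −1`, `p ≡ 1 (8)`, `(−7/p) = +1`: `dim₂ S ≤ 2`, `dim₂ S′ ≤ 3` (file 1,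
`card_twoIsogenySelmerGroup'_twoPrimesTwist_le_eight_threeOne`) and `rank + 2 ≤ dim₂ S + dim₂ S′` (`twoIsogeny_mordellWeilRank_add_two_le_holds`)
give **`rank E(ℚ) ≤ 3`** for `E = [0, −42qp, 0, 448q²p², 0]`, transported to **every model `W`** (`smul_eq_twoTorsionModel_of_smul_eq_quadraticTwist` +
`mordellWeilRank_variableChange_holds`).
§3 **Cells C1 and b31+** (binders = the capstone R p725669's LETTER FOR LETTER minus `hcell`, plus the cell clause exactly as in OBJECT 9's
`not_forall_mordellWeilRank_eq_one_cellC1` / `…_cellB31plus`): `rank W(ℚ) ≤ 3` for every `W`; **`rank W(ℚ) = 3` EXACTLY for every `W ≅ 49a1^{(−12806)}`**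
(`(q,p) = (19,337)`, C1) **and every `W ≅ 49a1^{(−53654)}`** (`(139,193)`, b31+), the lower bounds being OBJECT 9's kernel certificates; and the
two «`≤ 3` for all ∧ `= 3` attained» summaries.
HONEST FRAMING: the textbook first-descent bound made kernel for this family, completing the rows C1 and b31+ of the sixteen-cell map («rank ≤ 3
unconditionally, = 3 attained»); first descent only; NO width change (C1 = BARRIER cell 'RankNotSumOfLocalInvariants', b31+ = second descent /
`rk₄ ≥ 1` — both stay director width; not a road to rank one); items 19349 / 19350 / 20044 / 19140 neither closed nor advanced; twist-density of the
two-primes family ZERO; BSD is not proved by any of this.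

References: [SilvermanAEC2009] Prop. X.4.9, Example X.4.10, III.3.1(b); [SilvermanTate2015] §3.6; [Zywina2025] Lemma 3.1 (proof).
-/

noncomputable section

open scoped Classical

open WeierstrassCurve Literature.NumberTheory.EllipticCurves

namespace Summit.BirchSwinnertonDyer.BirchSwinnertonDyer.Theorems.GoldfeldGoodTwists

/-! ## §1 `S(−42qp, 448q²p²) ⊆ {1, 7, p, 7p, 2p, 14p}` on `q ≡ 3 (8)`, `(q/7) = −1`, `p ≡ 1 (4)` -/

section SelmerSThreeOne
variable {q p : ℕ} [Fact q.Prime] [Fact p.Prime]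

/-- A natural number not divisible by the prime `ℓ` is non-zero in `ZMod ℓ`, as an integer cast. [folklore] -/
private theorem intCast_ne_zero_of_not_dvd_sThree {l : ℕ} [Fact l.Prime] {n : ℕ} (h : ¬ l ∣ n) : ((n : ℤ) : ZMod l) ≠ 0 := by
  rw [Int.cast_natCast, Ne, ZMod.natCast_eq_zero_iff]; exact h

/-- `ℓ ∤ 2^a · 7^b` for a prime `ℓ ∉ {2, 7}`. [folklore] -/
private theorem not_dvd_two_pow_mul_seven_pow_sThree {l : ℕ} (hl : l.Prime) (hl2 : l ≠ 2) (hl7 : l ≠ 7) (a b : ℕ) : ¬ l ∣ 2 ^ a * 7 ^ b := by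
  intro h
  rcases (Nat.Prime.dvd_mul hl).mp h with h | h
  · exact hl2 ((Nat.prime_dvd_prime_iff_eq hl Nat.prime_two).mp (hl.dvd_of_dvd_pow h))
  · exact hl7 ((Nat.prime_dvd_prime_iff_eq hl (by norm_num)).mp (hl.dvd_of_dvd_pow h))

set_option maxHeartbeats 400000 in -- sixteen positive classes, each with its local computation
/-- **`S(−42qp, 448q²p²) ⊆ {1, 7, p, 7p, 2p, 14p}`** for `q ≡ 3 (8)`, `(q/7) = −1`, `p ≡ 1 (4)` prime (no `(−7/p)`, no type, no `(p/q)`): negatives at `ℝ`,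
the `q`-classes at `q`, `2, 14` at `q`. [cite: SilvermanAEC2009, Prop. X.4.9 and Example X.4.10] [cite: Zywina2025, Lemma 3.1 (proof)] -/
theorem twoIsogenySelmerGroup_twoPrimesTwist_subset_six_threeMod (hq8 : q % 8 = 3) (hq7 : jacobiSym q 7 = -1) (hp4 : p % 4 = 1) :
    twoIsogenySelmerGroup (-42 * ((q : ℤ) * p)) (448 * ((q : ℤ) * p) ^ 2) ⊆
      ({1, 7, (p : ℤ), (p : ℤ) * 2, (p : ℤ) * 7, (p : ℤ) * 14} : Finset ℤ) := by
  have hq4 : q % 4 = 3 := by omega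
  have hq : q.Prime := Fact.out
  have hp : p.Prime := Fact.out
  have hqZ : Prime (q : ℤ) := Nat.prime_iff_prime_int.mp hq
  have hpZ : Prime (p : ℤ) := Nat.prime_iff_prime_int.mp hp
  have hq0 : (q : ℤ) ≠ 0 := by exact_mod_cast hq.ne_zero
  have hp0 : (p : ℤ) ≠ 0 := by exact_mod_cast hp.ne_zero
  have hq2 : q ≠ 2 := by rintro rfl; norm_num at hq4
  have hqp : q ≠ p := by rintro rfl; omega
  have hq7' : q ≠ 7 := by
    rintro rfl; rw [jacobiSym.mod_left] at hq7; norm_num at hq7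
  obtain ⟨h7q, hm7q⟩ := legendreSym_seven_and_neg_seven_of_three_mod_four hq4 hq7
  have h2q : legendreSym q 2 = -1 := by
    rw [legendreSym.at_two hq2, ZMod.χ₈_nat_eq_if_mod_eight]; simp [hq8, show q % 2 = 1 by omega]
  -- non-vanishing modulo `q`
  have hpq0 : (p : ZMod q) ≠ 0 := by
    have := intCast_ne_zero_of_not_dvd_sThree (l := q) (fun h ↦ hqp ((Nat.prime_dvd_prime_iff_eq hq hp).mp h)); exact_mod_cast this
  have hcq : ∀ a b : ℕ, (((2 ^ a * 7 ^ b : ℕ) : ℤ) : ZMod q) ≠ 0 := fun a b ↦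
    intCast_ne_zero_of_not_dvd_sThree (not_dvd_two_pow_mul_seven_pow_sThree hq hq2 hq7' a b)
  have h4q : ((4 : ℤ) : ZMod q) ≠ 0 := by have := hcq 2 0; norm_num at this; exact_mod_cast this
  have h2pq : ((2 * p : ℤ) : ZMod q) ≠ 0 := by
    have h2 := hcq 1 0; norm_num at h2; push_cast; exact mul_ne_zero (by exact_mod_cast h2) hpq0
  have h4pq : ((4 * p : ℤ) : ZMod q) ≠ 0 := by push_cast; exact mul_ne_zero (by exact_mod_cast h4q) hpq0
  -- the non-residues `2, 14` modulo `q` and their cofactors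
  have hns_2_q : ¬ IsSquare (((2 : ℤ)) : ZMod q) := (legendreSym.eq_neg_one_iff q).mp h2q
  have hns_14_q : ¬ IsSquare (((14 : ℤ)) : ZMod q) :=
    (legendreSym.eq_neg_one_iff q).mp (by rw [show (14 : ℤ) = 2 * 7 by norm_num, legendreSym.mul, h2q, h7q]; norm_num)
  have hns_224pp_q : ¬ IsSquare (((224 * p ^ 2 : ℤ)) : ZMod q) := by
    rw [show (224 * p ^ 2 : ℤ) = 14 * (4 * p) ^ 2 by ring]; exact not_isSquare_mul_sq_zmod h4pq hns_14_q
  have hns_32pp_q : ¬ IsSquare (((32 * p ^ 2 : ℤ)) : ZMod q) := by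
    rw [show (32 * p ^ 2 : ℤ) = 2 * (4 * p) ^ 2 by ring]; exact not_isSquare_mul_sq_zmod h4pq hns_2_q
  have hns_disc_q : ¬ IsSquare ((((-42 * p) ^ 2 - 4 * (448 * p ^ 2) : ℤ)) : ZMod q) := by
    rw [show ((-42 * p) ^ 2 - 4 * (448 * p ^ 2) : ℤ) = -7 * (2 * p) ^ 2 by ring]
    exact not_isSquare_mul_sq_zmod h2pq ((legendreSym.eq_neg_one_iff q).mp hm7q)
  have hb : (448 * ((q : ℤ) * p) ^ 2 : ℤ) ≠ 0 := by positivity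
  intro d hd
  rw [mem_twoIsogenySelmerGroup_iff hb] at hd
  obtain ⟨hsqf, ⟨d', hdd'⟩, hloc⟩ := hd
  have hd'eq : (448 * ((q : ℤ) * p) ^ 2 : ℤ) / d = d' := by rw [hdd', Int.mul_ediv_cancel_left _ hsqf.ne_zero]
  rw [hd'eq] at hloc
  obtain ⟨hreal, hpadic⟩ := hloc
  simp only [Finset.mem_insert, Finset.mem_singleton]
  -- negatives die at `ℝ`
  have hdpos : 0 < d := by
    rcases lt_or_gt_of_ne hsqf.ne_zero with hneg | hpos
    · exfalso
      have hbpos : (0 : ℤ) < 448 * ((q : ℤ) * p) ^ 2 := by positivity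
      have hd'neg : d' < 0 := by
        by_contra hcon
        nlinarith [mul_nonpos_iff.mpr (Or.inr ⟨hneg.le, le_of_not_gt hcon⟩)]
      have ha : (-42 * ((q : ℤ) * p)) ≤ 0 := by
        have : (0 : ℤ) ≤ (q : ℤ) * p := by positivity
        linarith
      exact not_isSoluble_real_twoIsogenyQuartic_of_neg hneg hd'neg ha hreal
    · exact hpos
  -- the `q`-classes die at `q`
  have hqd : ¬ (q : ℤ) ∣ d := by
    rintro ⟨e, rfl⟩
    have h1 : e * d' = 448 * q * p ^ 2 := mul_left_cancel₀ hq0 (by linear_combination (-1 : ℤ) * hdd')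
    have h3 : (q : ℤ) ∣ e * d' := ⟨448 * p ^ 2, by rw [h1]; ring⟩
    rcases hqZ.dvd_or_dvd h3 with h4 | h4
    · obtain ⟨e₁, rfl⟩ := h4
      exact hqZ.not_unit (hsqf (q : ℤ) ⟨e₁, by ring⟩)
    · obtain ⟨e', rfl⟩ := h4
      have hm : e * e' = 448 * p ^ 2 := mul_left_cancel₀ hq0 (by linear_combination h1)
      exact not_isSoluble_padic_of_prime_dvd_coeffs (p := q) (c := -42 * p) (by ring) rfl rfl hm hns_disc_q (hpadic q)
  -- `d ∣ 14qp` prime to `q`: `d ∣ 14p`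
  have h0 : d ∣ 448 * ((q : ℤ) * p) ^ 2 := ⟨d', hdd'⟩
  have h1 : d ∣ (14 * ((q : ℤ) * p)) ^ 6 := h0.trans ⟨16807 * ((q : ℤ) * p) ^ 4, by ring⟩
  have h14qp : d ∣ 14 * ((q : ℤ) * p) := (hsqf.dvd_pow_iff_dvd (by norm_num)).mp h1
  have hcopq : IsCoprime d (q : ℤ) := ((hqZ.irreducible.coprime_iff_not_dvd).mpr hqd).symm
  have h14p : d ∣ 14 * (p : ℤ) := by
    have : d ∣ (q : ℤ) * (14 * p) := by rw [show (q : ℤ) * (14 * p) = 14 * (q * p) by ring]; exact h14qp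
    exact hcopq.dvd_of_dvd_mul_left this
  by_cases hpd : (p : ℤ) ∣ d
  · -- `d = p·e`, `e ∣ 14`, `e > 0`: all four are in the six-set
    obtain ⟨e, rfl⟩ := hpd
    have he14 : e ∣ 14 := by
      have : (p : ℤ) * e ∣ (p : ℤ) * 14 := by rw [mul_comm (p : ℤ) 14]; exact h14p
      exact (mul_dvd_mul_iff_left hp0).mp this
    have hepos : 0 < e := pos_of_mul_pos_right hdpos (by positivity)
    have hele : e ≤ 14 := Int.le_of_dvd (by norm_num) he14
    obtain ⟨k, hk⟩ := he14
    interval_cases e <;> first | (exfalso; omega) | simp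
  · -- `d ∣ 14`, `d > 0`: `2`, `14` die at `q`, `1`, `7` survive
    have hcopp : IsCoprime d (p : ℤ) := ((hpZ.irreducible.coprime_iff_not_dvd).mpr hpd).symm
    have hd14 : d ∣ 14 := hcopp.dvd_of_dvd_mul_right h14p
    have hle : d ≤ 14 := Int.le_of_dvd (by norm_num) hd14
    have hne2 : d ≠ 2 := by
      rintro rfl
      exact not_isSoluble_padic_of_nonresidue_of_sq_dvd (p := q) (c := -42 * p) (e' := 224 * p ^ 2) (by ring)
        (show d' = (q : ℤ) ^ 2 * (224 * p ^ 2) by linarith) hns_2_q hns_224pp_q (hpadic q)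
    have hne14 : d ≠ 14 := by
      rintro rfl
      exact not_isSoluble_padic_of_nonresidue_of_sq_dvd (p := q) (c := -42 * p) (e' := 32 * p ^ 2) (by ring)
        (show d' = (q : ℤ) ^ 2 * (32 * p ^ 2) by linarith) hns_14_q hns_32pp_q (hpadic q)
    obtain ⟨k, hk⟩ := hd14
    interval_cases d <;> first | (exfalso; omega) | simp

/-- **`#S(−42qp, 448q²p²) ≤ 6`** for `q ≡ 3 (8)`, `(q/7) = −1`, `p ≡ 1 (4)` (so `dim₂ S ≤ 2`, `#S` being a power of two). [cite: SilvermanAEC2009, Prop. X.4.9] -/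
theorem card_twoIsogenySelmerGroup_twoPrimesTwist_le_six_threeMod (hq8 : q % 8 = 3) (hq7 : jacobiSym q 7 = -1) (hp4 : p % 4 = 1) :
    (twoIsogenySelmerGroup (-42 * ((q : ℤ) * p)) (448 * ((q : ℤ) * p) ^ 2)).card ≤ 6 :=
  (Finset.card_le_card (twoIsogenySelmerGroup_twoPrimesTwist_subset_six_threeMod hq8 hq7 hp4)).trans Finset.card_le_six

/-- **`#S(−42qp, 448q²p²) ≤ 4`, i.e. `dim₂ S ≤ 2`,** for `q ≡ 3 (8)`, `(q/7) = −1`, `p ≡ 1 (4)`: `#S ≤ 6` and `#S = 2^{dim₂ S}` is a power of two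
(the tree's `two_pow_twoIsogenySelmerRank_eq_card`, BY NAME — no case split on `(p/q)` or the type). Sharp on C1, C2 and b31+ by the kit.
[cite: SilvermanAEC2009, Prop. X.4.9] -/
theorem card_twoIsogenySelmerGroup_twoPrimesTwist_le_four_threeMod (hq8 : q % 8 = 3) (hq7 : jacobiSym q 7 = -1) (hp4 : p % 4 = 1) :
    (twoIsogenySelmerGroup (-42 * ((q : ℤ) * p)) (448 * ((q : ℤ) * p) ^ 2)).card ≤ 4 := by
  have hq : q.Prime := Fact.out
  have hp : p.Prime := Fact.out
  have hq0 : (q : ℤ) ≠ 0 := by exact_mod_cast hq.ne_zero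
  have hp0 : (p : ℤ) ≠ 0 := by exact_mod_cast hp.ne_zero
  have hab : (448 * ((q : ℤ) * p) ^ 2) * ((-42 * ((q : ℤ) * p)) ^ 2 - 4 * (448 * ((q : ℤ) * p) ^ 2)) ≠ 0 := by
    rw [show (-42 * ((q : ℤ) * p)) ^ 2 - 4 * (448 * ((q : ℤ) * p) ^ 2) = -28 * ((q : ℤ) * p) ^ 2 by ring]
    exact mul_ne_zero (by positivity) (mul_ne_zero (by norm_num) (pow_ne_zero 2 (mul_ne_zero hq0 hp0)))
  have h6 := card_twoIsogenySelmerGroup_twoPrimesTwist_le_six_threeMod hq8 hq7 hp4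
  have e1 := two_pow_twoIsogenySelmerRank_eq_card hab
  have hsr : twoIsogenySelmerRank (-42 * ((q : ℤ) * p)) (448 * ((q : ℤ) * p) ^ 2) ≤ 2 := by
    by_contra hc
    have h3 : 2 ^ 3 ≤ 2 ^ twoIsogenySelmerRank (-42 * ((q : ℤ) * p)) (448 * ((q : ℤ) * p) ^ 2) := Nat.pow_le_pow_right (by norm_num) (by omega)
    omega
  calc (twoIsogenySelmerGroup (-42 * ((q : ℤ) * p)) (448 * ((q : ℤ) * p) ^ 2)).card
      = 2 ^ twoIsogenySelmerRank (-42 * ((q : ℤ) * p)) (448 * ((q : ℤ) * p) ^ 2) := e1.symm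
    _ ≤ 2 ^ 2 := Nat.pow_le_pow_right (by norm_num) hsr

/-! ## §2 The count: `rank ≤ 3` on the stratum `q ≡ 3 (8)`, `p ≡ 1 (8)` -/

/-- **`rank E(ℚ) ≤ 3`** for the two-torsion model `E = [0, −42qp, 0, 448q²p², 0]` of `49a1^{(−2qp)}` on the stratum `q ≡ 3 (8)`, `(q/7) = −1`,
`p ≡ 1 (8)`, `(−7/p) = +1`: `2^{dim S} = #S ≤ 4 ⇒ dim S ≤ 2`, `2^{dim S′} = #S′ ≤ 8 ⇒ dim S′ ≤ 3`, `rank + 2 ≤ dim S + dim S′`. UNCONDITIONAL, fact-free.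
[cite: SilvermanTate2015, §3.6 (2^r = #α(Γ)·#ᾱ(Γ̄)/4)] [cite: SilvermanAEC2009, Prop. X.4.7] -/
theorem mordellWeilRank_le_three_twoTorsionModel_twoPrimesTwist_threeOne (hq8 : q % 8 = 3) (hq7 : jacobiSym q 7 = -1) (hp8 : p % 8 = 1)
    (hp7 : legendreSym p (-7) = 1) :
    (⟨0, ((-42 * ((q : ℤ) * p) : ℤ) : ℚ), 0, ((448 * ((q : ℤ) * p) ^ 2 : ℤ) : ℚ), 0⟩ : WeierstrassCurve ℚ).mordellWeilRank ≤ 3 := by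
  have hq : q.Prime := Fact.out
  have hp : p.Prime := Fact.out
  have hq0 : (q : ℤ) ≠ 0 := by exact_mod_cast hq.ne_zero
  have hp0 : (p : ℤ) ≠ 0 := by exact_mod_cast hp.ne_zero
  have hab : (448 * ((q : ℤ) * p) ^ 2) * ((-42 * ((q : ℤ) * p)) ^ 2 - 4 * (448 * ((q : ℤ) * p) ^ 2)) ≠ 0 := by
    rw [show (-42 * ((q : ℤ) * p)) ^ 2 - 4 * (448 * ((q : ℤ) * p) ^ 2) = -28 * ((q : ℤ) * p) ^ 2 by ring]
    exact mul_ne_zero (by positivity) (mul_ne_zero (by norm_num) (pow_ne_zero 2 (mul_ne_zero hq0 hp0)))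
  have h := twoIsogeny_mordellWeilRank_add_two_le_holds (-42 * ((q : ℤ) * p)) (448 * ((q : ℤ) * p) ^ 2) hab
  have hS := card_twoIsogenySelmerGroup_twoPrimesTwist_le_four_threeMod hq8 hq7 (by omega : p % 4 = 1)
  have hS' := card_twoIsogenySelmerGroup'_twoPrimesTwist_le_eight_threeOne hq8 hq7 hp8 hp7
  have e1 := two_pow_twoIsogenySelmerRank_eq_card hab
  have e2 := two_pow_twoIsogenySelmerRank'_eq_card hab
  have hsr : twoIsogenySelmerRank (-42 * ((q : ℤ) * p)) (448 * ((q : ℤ) * p) ^ 2) ≤ 2 := by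
    by_contra hc
    have h3 : 2 ^ 3 ≤ 2 ^ twoIsogenySelmerRank (-42 * ((q : ℤ) * p)) (448 * ((q : ℤ) * p) ^ 2) := Nat.pow_le_pow_right (by norm_num) (by omega)
    omega
  have hsr' : twoIsogenySelmerRank' (-42 * ((q : ℤ) * p)) (448 * ((q : ℤ) * p) ^ 2) ≤ 3 := by
    by_contra hc
    have h4 : 2 ^ 4 ≤ 2 ^ twoIsogenySelmerRank' (-42 * ((q : ℤ) * p)) (448 * ((q : ℤ) * p) ^ 2) := Nat.pow_le_pow_right (by norm_num) (by omega)
    omega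
  omega

/-- **`rank W(ℚ) ≤ 3` for EVERY model `W` of `49a1^{(−2qp)}` on the stratum** `q ≡ 3 (8)`, `(q/7) = −1`, `p ≡ 1 (8)`, `(−7/p) = +1` (cells (β,−), a31+
— where the landed sharp descents give `≤ 1` — and the `(4,8)` cells C1, b31+), in the capstone's spelling `C • W = cm7.quadraticTwist (−(2·q·p))`; transport by
the lane's `smul_eq_twoTorsionModel_of_smul_eq_quadraticTwist` + `mordellWeilRank_variableChange_holds`. [cite: SilvermanAEC2009, III.3.1(b) and VIII.6]
[cite: SilvermanTate2015, §3.6] -/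
theorem mordellWeilRank_le_three_twoPrimesTwist_threeOne (hq8 : q % 8 = 3) (hq7 : jacobiSym q 7 = -1) (hp8 : p % 8 = 1)
    (hp7 : legendreSym p (-7) = 1) (W : WeierstrassCurve ℚ) [W.IsElliptic] (C : VariableChange ℚ)
    (hC : C • W = cm7.quadraticTwist (-(2 * (q : ℚ) * p))) : W.mordellWeilRank ≤ 3 := by
  have hC' : C • W = cm7.quadraticTwist (((-2 * ((q : ℤ) * p) : ℤ)) : ℚ) := by
    rw [hC]; congr 1; push_cast; ring
  have hE := (smul_eq_twoTorsionModel_of_smul_eq_quadraticTwist (-2 * ((q : ℤ) * p)) W C hC').trans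
    (show (⟨0, ((21 * (-2 * ((q : ℤ) * p)) : ℤ) : ℚ), 0, ((112 * (-2 * ((q : ℤ) * p)) ^ 2 : ℤ) : ℚ), 0⟩ : WeierstrassCurve ℚ) =
        ⟨0, ((-42 * ((q : ℤ) * p) : ℤ) : ℚ), 0, ((448 * ((q : ℤ) * p) ^ 2 : ℤ) : ℚ), 0⟩ by
      ext <;> push_cast <;> ring)
  have hrk := mordellWeilRank_variableChange_holds W
    ((⟨(Units.mk0 (2 : ℚ) two_ne_zero)⁻¹, 2 * (((-2 * ((q : ℤ) * p) : ℤ)) : ℚ), 0, 0⟩ : VariableChange ℚ) * C)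
  unfold mordellWeilRank_variableChange at hrk
  rw [← hrk, hE]
  exact mordellWeilRank_le_three_twoTorsionModel_twoPrimesTwist_threeOne hq8 hq7 hp8 hp7

end SelmerSThreeOne

/-! ## §3 Cells C1 and b31+: `rank ≤ 3` for all, `= 3` attained -/

section CellsC1B31

/-- **Cell C1: `rank W(ℚ) ≤ 3` for every `W ≅ 49a1^{(−2qp)}`** — binders = the capstone R p725669's LETTER FOR LETTER minus `hcell`, plus the C1 clause
`(p/q) = −1 ∧ q ≡ 3 (8) ∧ α ∧ p ≡ 1 (8)` exactly as in OBJECT 9's `not_forall_mordellWeilRank_eq_one_cellC1` (where «`rank W(ℚ) = 1` for every such `W`» is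
refuted). [cite: SilvermanTate2015, §3.6] -/
theorem mordellWeilRank_le_three_twoPrimesTwist_cellC1 {q p : ℕ} (hq : q.Prime) (_h3 : 3 < q) (_hq4 : q % 4 = 3) (hq7 : jacobiSym q 7 = -1)
    [Fact p.Prime] (_hp4 : p % 4 = 1) (hp7 : legendreSym p (-7) = 1)
    (hcell : jacobiSym (p : ℤ) q = -1 ∧ q % 8 = 3 ∧ (¬ ∃ x : ZMod p, x ^ 4 = -7) ∧ p % 8 = 1)
    (W : WeierstrassCurve ℚ) [W.IsElliptic] (C : VariableChange ℚ) (hC : C • W = cm7.quadraticTwist (-(2 * (q : ℚ) * p))) :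
    W.mordellWeilRank ≤ 3 := by
  haveI : Fact q.Prime := ⟨hq⟩
  exact mordellWeilRank_le_three_twoPrimesTwist_threeOne hcell.2.1 hq7 hcell.2.2.2 hp7 W C hC

/-- **Cell b31+: `rank W(ℚ) ≤ 3` for every `W ≅ 49a1^{(−2qp)}`** — binders = the capstone's minus `hcell`, plus the b31+ clause
`(p/q) = +1 ∧ β ∧ p ≡ 1 (8) ∧ q ≡ 3 (8)` exactly as in OBJECT 9's `not_forall_mordellWeilRank_eq_one_cellB31plus`. [cite: SilvermanTate2015, §3.6] -/
theorem mordellWeilRank_le_three_twoPrimesTwist_cellB31plus {q p : ℕ} (hq : q.Prime) (_h3 : 3 < q) (_hq4 : q % 4 = 3) (hq7 : jacobiSym q 7 = -1)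
    [Fact p.Prime] (_hp4 : p % 4 = 1) (hp7 : legendreSym p (-7) = 1)
    (hcell : jacobiSym (p : ℤ) q = 1 ∧ (∃ x : ZMod p, x ^ 4 = -7) ∧ p % 8 = 1 ∧ q % 8 = 3)
    (W : WeierstrassCurve ℚ) [W.IsElliptic] (C : VariableChange ℚ) (hC : C • W = cm7.quadraticTwist (-(2 * (q : ℚ) * p))) :
    W.mordellWeilRank ≤ 3 := by
  haveI : Fact q.Prime := ⟨hq⟩
  exact mordellWeilRank_le_three_twoPrimesTwist_threeOne hcell.2.2.2 hq7 hcell.2.2.1 hp7 W C hC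

/-- **`rank W(ℚ) = 3` EXACTLY for every model `W` of `49a1^{(−2·19·337)} = 49a1^{(−12806)}`** (cell C1): `≤ 3` by §2, `3 ≤` by OBJECT 9's kernel
certificate `three_le_mordellWeilRank_twoPrimesTwist_19_337`. UNCONDITIONAL, fact-free. [cite: SilvermanTate2015, §3.6] -/
theorem mordellWeilRank_eq_three_twoPrimesTwist_19_337 (W : WeierstrassCurve ℚ) [W.IsElliptic] (C : VariableChange ℚ)
    (hC : C • W = cm7.quadraticTwist (-(2 * ((19 : ℕ) : ℚ) * ((337 : ℕ) : ℚ)))) : W.mordellWeilRank = 3 := by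
  obtain ⟨hq, hp, hq8, hq7, hp8, hp7, -, -⟩ := cellC1_19_337
  haveI : Fact (Nat.Prime 19) := ⟨hq⟩
  haveI : Fact (Nat.Prime 337) := ⟨hp⟩
  refine le_antisymm ?_ (three_le_mordellWeilRank_twoPrimesTwist_19_337 W C hC)
  exact mordellWeilRank_le_three_twoPrimesTwist_threeOne (q := 19) (p := 337) hq8 hq7 hp8
    (by rw [legendreSym_neg_seven_eq_jacobiSym (by norm_num)]; exact hp7) W C hC

/-- **`rank W(ℚ) = 3` EXACTLY for every model `W` of `49a1^{(−2·139·193)} = 49a1^{(−53654)}`** (cell b31+): `≤ 3` by §2, `3 ≤` by OBJECT 9's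
`three_le_mordellWeilRank_twoPrimesTwist_139_193`. UNCONDITIONAL, fact-free. [cite: SilvermanTate2015, §3.6] -/
theorem mordellWeilRank_eq_three_twoPrimesTwist_139_193 (W : WeierstrassCurve ℚ) [W.IsElliptic] (C : VariableChange ℚ)
    (hC : C • W = cm7.quadraticTwist (-(2 * ((139 : ℕ) : ℚ) * ((193 : ℕ) : ℚ)))) : W.mordellWeilRank = 3 := by
  obtain ⟨hq, hp, hq8, hq7, hp8, hp7, -, -⟩ := cellB31_139_193
  haveI : Fact (Nat.Prime 139) := ⟨hq⟩
  haveI : Fact (Nat.Prime 193) := ⟨hp⟩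
  refine le_antisymm ?_ (three_le_mordellWeilRank_twoPrimesTwist_139_193 W C hC)
  exact mordellWeilRank_le_three_twoPrimesTwist_threeOne (q := 139) (p := 193) hq8 hq7 hp8
    (by rw [legendreSym_neg_seven_eq_jacobiSym (by norm_num)]; exact hp7) W C hC

/-- **C1 summary: `rank ≤ 3` for every `W` on the cell, and a member (`(q,p) = (19,337)`) with `rank = 3`.** [cite: SilvermanTate2015, §3.6] -/
theorem mordellWeilRank_le_three_and_attained_cellC1 :
    (∀ {q p : ℕ} (_ : q.Prime) (_ : 3 < q) (_ : q % 4 = 3) (_ : jacobiSym q 7 = -1) [Fact p.Prime] (_ : p % 4 = 1)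
        (_ : legendreSym p (-7) = 1) (_ : jacobiSym (p : ℤ) q = -1 ∧ q % 8 = 3 ∧ (¬ ∃ x : ZMod p, x ^ 4 = -7) ∧ p % 8 = 1)
        (W : WeierstrassCurve ℚ) [W.IsElliptic] (C : VariableChange ℚ),
        C • W = cm7.quadraticTwist (-(2 * (q : ℚ) * p)) → W.mordellWeilRank ≤ 3) ∧
    (∃ (q p : ℕ) (_ : q.Prime) (_ : 3 < q) (_ : q % 4 = 3) (_ : jacobiSym q 7 = -1) (_ : Fact p.Prime) (_ : p % 4 = 1)
        (_ : legendreSym p (-7) = 1) (_ : jacobiSym (p : ℤ) q = -1 ∧ q % 8 = 3 ∧ (¬ ∃ x : ZMod p, x ^ 4 = -7) ∧ p % 8 = 1)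
        (W : WeierstrassCurve ℚ) (_ : W.IsElliptic) (C : VariableChange ℚ),
        C • W = cm7.quadraticTwist (-(2 * (q : ℚ) * p)) ∧ W.mordellWeilRank = 3) := by
  refine ⟨fun hq h3 hq4 hq7 _ hp4 hp7 hcell W _ C hC ↦
    mordellWeilRank_le_three_twoPrimesTwist_cellC1 hq h3 hq4 hq7 hp4 hp7 hcell W C hC, ?_⟩
  obtain ⟨hq, hp, hq8, hq7, hp8, hp7, hpq, htyp⟩ := cellC1_19_337
  haveI : Fact (Nat.Prime 337) := ⟨hp⟩
  haveI := isElliptic_quadraticTwist (W := cm7) (d := -(2 * ((19 : ℕ) : ℚ) * ((337 : ℕ) : ℚ))) (by norm_num)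
  exact ⟨19, 337, hq, by norm_num, by norm_num, hq7, inferInstance, by norm_num,
    by rw [legendreSym_neg_seven_eq_jacobiSym (by norm_num)]; exact hp7, ⟨by exact_mod_cast hpq, hq8, htyp, hp8⟩,
    cm7.quadraticTwist (-(2 * ((19 : ℕ) : ℚ) * ((337 : ℕ) : ℚ))), inferInstance, 1, one_smul _ _,
    mordellWeilRank_eq_three_twoPrimesTwist_19_337 _ 1 (one_smul _ _)⟩

/-- **b31+ summary: `rank ≤ 3` for every `W` on the cell, and a member (`(q,p) = (139,193)`) with `rank = 3`.** [cite: SilvermanTate2015, §3.6] -/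
theorem mordellWeilRank_le_three_and_attained_cellB31plus :
    (∀ {q p : ℕ} (_ : q.Prime) (_ : 3 < q) (_ : q % 4 = 3) (_ : jacobiSym q 7 = -1) [Fact p.Prime] (_ : p % 4 = 1)
        (_ : legendreSym p (-7) = 1) (_ : jacobiSym (p : ℤ) q = 1 ∧ (∃ x : ZMod p, x ^ 4 = -7) ∧ p % 8 = 1 ∧ q % 8 = 3)
        (W : WeierstrassCurve ℚ) [W.IsElliptic] (C : VariableChange ℚ),
        C • W = cm7.quadraticTwist (-(2 * (q : ℚ) * p)) → W.mordellWeilRank ≤ 3) ∧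
    (∃ (q p : ℕ) (_ : q.Prime) (_ : 3 < q) (_ : q % 4 = 3) (_ : jacobiSym q 7 = -1) (_ : Fact p.Prime) (_ : p % 4 = 1)
        (_ : legendreSym p (-7) = 1) (_ : jacobiSym (p : ℤ) q = 1 ∧ (∃ x : ZMod p, x ^ 4 = -7) ∧ p % 8 = 1 ∧ q % 8 = 3)
        (W : WeierstrassCurve ℚ) (_ : W.IsElliptic) (C : VariableChange ℚ),
        C • W = cm7.quadraticTwist (-(2 * (q : ℚ) * p)) ∧ W.mordellWeilRank = 3) := by
  refine ⟨fun hq h3 hq4 hq7 _ hp4 hp7 hcell W _ C hC ↦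
    mordellWeilRank_le_three_twoPrimesTwist_cellB31plus hq h3 hq4 hq7 hp4 hp7 hcell W C hC, ?_⟩
  obtain ⟨hq, hp, hq8, hq7, hp8, hp7, hpq, htyp⟩ := cellB31_139_193
  haveI : Fact (Nat.Prime 193) := ⟨hp⟩
  haveI := isElliptic_quadraticTwist (W := cm7) (d := -(2 * ((139 : ℕ) : ℚ) * ((193 : ℕ) : ℚ))) (by norm_num)
  exact ⟨139, 193, hq, by norm_num, by norm_num, hq7, inferInstance, by norm_num,
    by rw [legendreSym_neg_seven_eq_jacobiSym (by norm_num)]; exact hp7, ⟨by exact_mod_cast hpq, htyp, hp8, hq8⟩,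
    cm7.quadraticTwist (-(2 * ((139 : ℕ) : ℚ) * ((193 : ℕ) : ℚ))), inferInstance, 1, one_smul _ _,
    mordellWeilRank_eq_three_twoPrimesTwist_139_193 _ 1 (one_smul _ _)⟩

end CellsC1B31

end Summit.BirchSwinnertonDyer.BirchSwinnertonDyer.Theorems.GoldfeldGoodTwists

end
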